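import Summits.QuantumFields.YangMills.Theorems.FlatTubeReductionOrthoDensityDefs
import Summits.QuantumFields.YangMills.Theorems.LuscherReductionTwistedTraceScalingBOCentralChart
import Summits.QuantumFields.YangMills.Theorems.LuscherReductionOneSiteLevelsValleyAlgebra
import HarnessLib

/-!
# The flat chart map of the orthographic tube, I: the balancing fill, injectivity of the linearisation, and `gnoPoint ∘ orthoFlat = orthoTube ∘ (baseGno, balFill)`
# («(E′)-lite» infrastructure; route `FlatTubeReduction`, crux K1 `NearFlatRatioLaw` stmt-QuantumFields-24720; seat `ym-line-ftr-p1` g16; R2b1 RECORD rung — no summit statement is proved here)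

WHY (memo `Cruxes/NearFlatRatioLaw/Lines/ratepack-v5-nearpair-g16.md` §5; defs in `…OrthoDensityDefs`).  The two-sided comparison of the transverse measure `π = orthoTransverse L` with
Lebesgue measure of the balanced subspace goes through the product formula `σ³(B)·π(A) = σ^{⊗E}({orthoTube u⁻¹ v : u ∈ B, v ∈ A})` (`SlowChart.slowMeasure_prod`), the product GNOMONIC
chart of `SU(2)^E` (`GnChart.pi_haar_su2_eq_sum_piPatternChart`, density `Π_e (2π²)⁻¹(1+|z_e|²)⁻²`), and the FLAT map `G = orthoFlat L` (gnomonic coordinates of the tube point as a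
function of the flat data `y` = (base gnomonic coordinates, off-base transverse coordinates)).  This file: the algebra of `G`.
* §1 `balFill`: balanced (`balFill_mem_balancedSet`), identity on balanced vectors agreeing off the base (`balFill_eq_of_agree`, `balFill_eq_self`), `|balFill| ≤ N‖y‖`;
* §2 ★ `orthoFlatLin_injective`, `orthoFlatLin_det_ne_zero` — the differential at `0` is invertible (balance forces the base coordinates to vanish);
* §3 ★★ `orthoFlat_eq_gnLink`, `gnoPoint_orthoFlat` — for `‖y‖ ≤ 1/(4N)` every link of `orthoTube L (baseGno L y) (balFill L y)` lies in the open upper hemisphere and its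
  gnomonic coordinate is `orthoFlat L y e` (quaternion product `chartSU2 v · P(1,b)`: scalar `‖(1,b)‖⁻¹(p₀ − v·b)`, vector `‖(1,b)‖⁻¹(p₀b + v + v × b)`); `orthoFlat_zero`.
HONEST FRAMING: elementary algebra; femto rung R2b1 (RECORD label); not infinite volume, not a gap, not Clay.  No defs, no named facts, no `sorry`.
-/

set_option autoImplicit false

noncomputable section

open MeasureTheory Filter Topology Real
open scoped BigOperators Matrix
open Literature.MathematicalPhysics.QuantumFieldTheory
open Literature.MathematicalPhysics.QuantumLattice
open Literature.MathematicalPhysics.QuantumFieldTheory.Balaban1983to89.T4CubeChartGnomonic (gnoPoint)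

namespace Summit.QuantumFields.YangMills.Theorems.FemtoTransferGap.TwoLattice.ConstTube

open Summit.QuantumFields.YangMills.Theorems.FemtoTransferGap

variable (L : ℕ) [NeZero L]

/-! ## §1 The balancing fill -/

/-- Off the base site the fill keeps the coordinate. [folklore] -/
theorem balFill_apply_of_ne (y : Edge 3 L → Fin 3 → ℝ) {e : Edge 3 L} (h : ¬e.1 = 0) (a : Fin 3) : balFill L y e a = y e a := by
  rw [balFill_apply, if_neg h]

/-- On the base site the fill is the balancing sum. [folklore] -/
theorem balFill_apply_base (y : Edge 3 L → Fin 3 → ℝ) (k a : Fin 3) :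
    balFill L y ((0 : Site 3 L), k) a = -∑ x : {x : Site 3 L // ¬x = 0}, y (x.1, k) a := by
  rw [balFill_apply, if_pos rfl]

/-- A sum over the sites splits into the base site and the subtype of the others. [folklore] -/
theorem sum_site_eq_add_sum_subtype (f : Site 3 L → ℝ) : ∑ x : Site 3 L, f x = f 0 + ∑ x : {x : Site 3 L // ¬x = 0}, f x.1 := by
  rw [← Finset.add_sum_erase Finset.univ f (Finset.mem_univ (0 : Site 3 L))]
  congr 1
  exact Finset.sum_subtype (Finset.univ.erase (0 : Site 3 L)) (fun x => by simp [Finset.mem_erase]) f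

/-- ★ The fill is balanced: `Σ_x (balFill L y)_{(x,k)} = 0`. [folklore] -/
theorem balFill_mem_balancedSet (y : Edge 3 L → Fin 3 → ℝ) : balFill L y ∈ balancedSet L := by
  intro k a
  rw [sum_site_eq_add_sum_subtype, balFill_apply_base]
  have h : ∑ x : {x : Site 3 L // ¬x = 0}, balFill L y (x.1, k) a = ∑ x : {x : Site 3 L // ¬x = 0}, y (x.1, k) a :=
    Finset.sum_congr rfl fun x _ => balFill_apply_of_ne L y (e := (x.1, k)) x.2 a
  rw [h]; ring

/-- The range of `balExt` is balanced. [folklore] -/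
theorem balExt_mem_balancedSet (w : {e : Edge 3 L // ¬e.1 = 0} → Fin 3 → ℝ) : balExt L w ∈ balancedSet L := by
  have h : balExt L w = balFill L (fun e => if h : ¬e.1 = 0 then w ⟨e, h⟩ else 0) := by
    funext e a
    rw [balExt_apply, balFill_apply]
    by_cases he : e.1 = 0
    · rw [dif_pos he, if_pos he]
      congr 1
      exact Finset.sum_congr rfl fun x _ => by rw [dif_pos x.2]
    · rw [dif_neg he, if_neg he, dif_pos he]
  rw [h]; exact balFill_mem_balancedSet L _

/-- ★ The fill of a vector that is balanced and agrees with `y` off the base site is that vector: `balFill L y = v`. [folklore] -/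
theorem balFill_eq_of_agree {y v : Edge 3 L → Fin 3 → ℝ} (hv : v ∈ balancedSet L) (h : ∀ e : Edge 3 L, ¬e.1 = 0 → y e = v e) : balFill L y = v := by
  funext e a
  by_cases he : e.1 = 0
  · obtain ⟨x, k⟩ := e
    simp only at he
    subst he
    rw [balFill_apply_base]
    have hk := hv k a
    rw [sum_site_eq_add_sum_subtype] at hk
    have h2 : ∑ x : {x : Site 3 L // ¬x = 0}, y (x.1, k) a = ∑ x : {x : Site 3 L // ¬x = 0}, v (x.1, k) a :=
      Finset.sum_congr rfl fun x _ => by rw [h (x.1, k) x.2]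
    rw [h2]; linarith
  · rw [balFill_apply_of_ne L y he, h e he]

/-- A balanced vector is its own fill. [folklore] -/
theorem balFill_eq_self {v : Edge 3 L → Fin 3 → ℝ} (hv : v ∈ balancedSet L) : balFill L v = v := balFill_eq_of_agree L hv fun _ _ => rfl

/-- The fill of `y` is the balanced extension of the off-base coordinates of `y`. [folklore] -/
theorem balFill_eq_balExt (y : Edge 3 L → Fin 3 → ℝ) : balFill L y = balExt L (fun e' => y e'.1) := rfl

/-- A balanced vector is the balanced extension of its off-base coordinates. [folklore] -/
theorem balExt_restrict_eq_self {v : Edge 3 L → Fin 3 → ℝ} (hv : v ∈ balancedSet L) : balExt L (fun e' => v e'.1) = v := balFill_eq_self L hv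

/-- `balExt` is injective. [folklore] -/
theorem balExt_injective : Function.Injective (balExt L) := by
  intro w w' h
  funext e' a
  have := congrArg (fun z => z e'.1 a) h
  simpa only [balExt_apply, dif_neg e'.2] using this

/-- Coordinates are bounded by the sup norm: `|y e a| ≤ ‖y‖`. [folklore] -/
theorem abs_apply_le_norm (y : Edge 3 L → Fin 3 → ℝ) (e : Edge 3 L) (a : Fin 3) : |y e a| ≤ ‖y‖ := by
  rw [← Real.norm_eq_abs]
  exact (norm_le_pi_norm (y e) a).trans (norm_le_pi_norm y e)

/-- ★ The fill is bounded by `N·‖y‖`, `N = #sites`. [folklore] -/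
theorem abs_balFill_le (y : Edge 3 L → Fin 3 → ℝ) (e : Edge 3 L) (a : Fin 3) : |balFill L y e a| ≤ Fintype.card (Site 3 L) * ‖y‖ := by
  have hN : (1 : ℝ) ≤ Fintype.card (Site 3 L) := by exact_mod_cast Fintype.card_pos
  have hy0 : 0 ≤ ‖y‖ := norm_nonneg _
  by_cases he : e.1 = 0
  · rw [balFill_apply, if_pos he, abs_neg]
    calc |∑ x : {x : Site 3 L // ¬x = 0}, y (x.1, e.2) a| ≤ ∑ x : {x : Site 3 L // ¬x = 0}, |y (x.1, e.2) a| := Finset.abs_sum_le_sum_abs _ _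
      _ ≤ ∑ _x : {x : Site 3 L // ¬x = 0}, ‖y‖ := Finset.sum_le_sum fun x _ => abs_apply_le_norm L y _ a
      _ = Fintype.card {x : Site 3 L // ¬x = 0} * ‖y‖ := by rw [Finset.sum_const, Finset.card_univ, nsmul_eq_mul]
      _ ≤ Fintype.card (Site 3 L) * ‖y‖ := by
        refine mul_le_mul_of_nonneg_right ?_ hy0
        exact_mod_cast Fintype.card_subtype_le _
  · rw [balFill_apply_of_ne L y he]
    exact (abs_apply_le_norm L y e a).trans (le_mul_of_one_le_left hy0 hN)

/-- The sup norm of the fill: `‖balFill L y‖ ≤ N‖y‖`. [folklore] -/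
theorem norm_balFill_le (y : Edge 3 L → Fin 3 → ℝ) : ‖balFill L y‖ ≤ Fintype.card (Site 3 L) * ‖y‖ := by
  refine (pi_norm_le_iff_of_nonneg (by positivity)).2 fun e => (pi_norm_le_iff_of_nonneg (by positivity)).2 fun a => ?_
  rw [Real.norm_eq_abs]; exact abs_balFill_le L y e a

/-! ## §2 The linearisation is injective -/

/-- ★ **`orthoFlatLin L` is injective**: if `(balFill L y)_e + y_{(0,k(e))} = 0` for all `e` then, summing over the sites of direction `k`, balance gives `N·y_{(0,k)} = 0`,
whence `y = 0`. [folklore] -/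
theorem orthoFlatLin_injective : Function.Injective (orthoFlatLin L) := by
  refine (injective_iff_map_eq_zero _).2 fun y hy => ?_
  have hc : ∀ (e : Edge 3 L) (a : Fin 3), balFill L y e a + y (0, e.2) a = 0 := fun e a => by
    have := congrArg (fun z => z e a) hy
    simpa only [orthoFlatLin_apply, Pi.zero_apply] using this
  -- the base coordinates vanish
  have hb : ∀ k a : Fin 3, y (0, k) a = 0 := fun k a => by
    have hsum : ∑ x : Site 3 L, (balFill L y (x, k) a + y (0, k) a) = 0 := Finset.sum_eq_zero fun x _ => hc (x, k) a
    rw [Finset.sum_add_distrib, balFill_mem_balancedSet L y k a, zero_add, Finset.sum_const, Finset.card_univ, nsmul_eq_mul] at hsum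
    have hN : (0 : ℝ) < Fintype.card (Site 3 L) := by exact_mod_cast Fintype.card_pos
    exact (mul_eq_zero.1 hsum).resolve_left hN.ne'
  funext e a
  by_cases he : e.1 = 0
  · obtain ⟨x, k⟩ := e
    simp only at he
    subst he
    exact hb k a
  · have := hc e a
    rw [balFill_apply_of_ne L y he, hb, add_zero] at this
    exact this

/-- The linearisation has non-zero determinant. [folklore] -/
theorem orthoFlatLin_det_ne_zero : (orthoFlatLin L).det ≠ 0 := by
  have hinj : Function.Injective ((orthoFlatLin L : (Edge 3 L → Fin 3 → ℝ) →ₗ[ℝ] (Edge 3 L → Fin 3 → ℝ))) := orthoFlatLin_injective L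
  have hu : IsUnit ((orthoFlatLin L : (Edge 3 L → Fin 3 → ℝ) →ₗ[ℝ] (Edge 3 L → Fin 3 → ℝ))) := by
    rw [LinearMap.isUnit_iff_ker_eq_bot]
    exact LinearMap.ker_eq_bot.2 hinj
  exact (hu.map LinearMap.det).ne_zero

/-! ## §3 Identification with the orthographic tube: `gnoPoint ∘ orthoFlat = orthoTube ∘ (baseGno, balFill)` -/

/-- The scalar part of `chartSU2 v · P(1,b)`: `‖(1,b)‖⁻¹ (p₀ − v·b)`. [folklore] -/
theorem scalarPart_chartSU2_mul_gnoPoint {v : Fin 3 → ℝ} (hv : ∑ a, v a ^ 2 ≤ 1) (b : Fin 3 → ℝ) :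
    scalarPart (chartSU2 v * gnoPoint b) = ‖gnomonicQuat b‖⁻¹ * (Real.sqrt (1 - ∑ a, v a ^ 2) - v ⬝ᵥ b) := by
  rw [scalarPart_mul, scalarPart_chartSU2 hv, vecPart_chartSU2 hv, scalarPart_gnoPoint]
  have hb : vecPart (gnoPoint b) = ‖gnomonicQuat b‖⁻¹ • b := funext fun a => by rw [vecPart_gnoPoint, Pi.smul_apply, smul_eq_mul]
  rw [hb, dotProduct_smul, smul_eq_mul]; ring

/-- The vector part of `chartSU2 v · P(1,b)`: `‖(1,b)‖⁻¹ (p₀ b + v + v × b)`. [folklore] -/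
theorem vecPart_chartSU2_mul_gnoPoint {v : Fin 3 → ℝ} (hv : ∑ a, v a ^ 2 ≤ 1) (b : Fin 3 → ℝ) (a : Fin 3) :
    vecPart (chartSU2 v * gnoPoint b) a = ‖gnomonicQuat b‖⁻¹ * (Real.sqrt (1 - ∑ c, v c ^ 2) * b a + v a + (v ⨯₃ b) a) := by
  rw [vecPart_mul, scalarPart_chartSU2 hv, vecPart_chartSU2 hv, scalarPart_gnoPoint]
  have hb : vecPart (gnoPoint b) = ‖gnomonicQuat b‖⁻¹ • b := funext fun a => by rw [vecPart_gnoPoint, Pi.smul_apply, smul_eq_mul]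
  rw [hb, LinearMap.map_smul]
  simp only [Pi.add_apply, Pi.smul_apply, smul_eq_mul]
  ring

/-- ★ The gnomonic coordinates of `chartSU2 v · P(1,b)`: `(p₀ b + v + v × b)/(p₀ − v·b)`. [folklore] -/
theorem gnLink_chartSU2_mul_gnoPoint {v : Fin 3 → ℝ} (hv : ∑ a, v a ^ 2 ≤ 1) (b : Fin 3 → ℝ) (a : Fin 3) :
    gnLink (chartSU2 v * gnoPoint b) a =
      (Real.sqrt (1 - ∑ c, v c ^ 2) * b a + v a + (v ⨯₃ b) a) / (Real.sqrt (1 - ∑ c, v c ^ 2) - v ⬝ᵥ b) := by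
  rw [gnLink_apply, vecPart_chartSU2_mul_gnoPoint hv, scalarPart_chartSU2_mul_gnoPoint hv]
  have hg : (‖gnomonicQuat b‖⁻¹ : ℝ) ≠ 0 := inv_ne_zero (norm_gnomonicQuat_pos b).ne'
  rw [mul_div_mul_left _ _ hg]

omit [NeZero L] in
/-- The link of the tube at the base slow variable: `(orthoTube L (baseGno L y) v)_e = chartSU2 (v e) · P(1, y_{(0,k(e))})`. [folklore] -/
theorem orthoTube_baseGno_apply (y v : Edge 3 L → Fin 3 → ℝ) (e : Edge 3 L) : orthoTube L (baseGno L y) v e = chartSU2 (v e) * gnoPoint (y (0, e.2)) := rfl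

/-- ★★ **`orthoFlat` IS the gnomonic coordinate of the tube**: `orthoFlat L y e = gnLink ((orthoTube L (baseGno L y) (balFill L y)) e)` whenever `|v_e|² ≤ 1`. [folklore] -/
theorem orthoFlat_eq_gnLink (y : Edge 3 L → Fin 3 → ℝ) {e : Edge 3 L} (he : ∑ c, balFill L y e c ^ 2 ≤ 1) :
    orthoFlat L y e = gnLink (orthoTube L (baseGno L y) (balFill L y) e) := by
  funext a
  rw [orthoTube_baseGno_apply, gnLink_chartSU2_mul_gnoPoint he]
  rfl

/-- The sum of squares of three coordinates is at most `3‖·‖∞²`-type bound: `Σ_c v_c² ≤ 3M²` if `|v_c| ≤ M`. [folklore] -/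
theorem sum_sq_le_three_mul_sq {v : Fin 3 → ℝ} {M : ℝ} (h : ∀ c, |v c| ≤ M) : ∑ c, v c ^ 2 ≤ 3 * M ^ 2 := by
  have h1 : ∀ c, v c ^ 2 ≤ M ^ 2 := fun c => by rw [← sq_abs]; exact pow_le_pow_left₀ (abs_nonneg _) (h c) 2
  calc ∑ c, v c ^ 2 ≤ ∑ _c : Fin 3, M ^ 2 := Finset.sum_le_sum fun c _ => h1 c
    _ = 3 * M ^ 2 := by rw [Finset.sum_const, Finset.card_univ, Fintype.card_fin]; ring

/-- ★ **The smallness regime.**  If `‖y‖ ≤ 1/(4N)` (`N = #sites`) then for every link `e`: `Σ_c v_c² ≤ 3/16 ≤ 1`, `|v·b| ≤ 3/16`, and `p₀ − v·b ≥ 1/2`, where `v = (balFill L y)_e`,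
`b = y_{(0,k(e))}`, `p₀ = √(1 − Σ v_c²)`. [folklore] -/
theorem orthoFlat_regime {y : Edge 3 L → Fin 3 → ℝ} (hy : ‖y‖ ≤ 1 / (4 * Fintype.card (Site 3 L))) (e : Edge 3 L) :
    ∑ c, balFill L y e c ^ 2 ≤ 3 / 16 ∧ |balFill L y e ⬝ᵥ y (0, e.2)| ≤ 3 / 16 ∧
      1 / 2 ≤ Real.sqrt (1 - ∑ c, balFill L y e c ^ 2) - balFill L y e ⬝ᵥ y (0, e.2) := by
  have hN1 : (1 : ℝ) ≤ Fintype.card (Site 3 L) := by exact_mod_cast Fintype.card_pos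
  have hy0 : 0 ≤ ‖y‖ := norm_nonneg _
  have hv : ∀ c, |balFill L y e c| ≤ 1 / 4 := fun c => (abs_balFill_le L y e c).trans (by
    calc (Fintype.card (Site 3 L) : ℝ) * ‖y‖ ≤ Fintype.card (Site 3 L) * (1 / (4 * Fintype.card (Site 3 L))) := mul_le_mul_of_nonneg_left hy (by positivity)
      _ = 1 / 4 := by field_simp)
  have hb : ∀ c, |y (0, e.2) c| ≤ 1 / 4 := fun c => (abs_apply_le_norm L y _ c).trans (hy.trans
    (one_div_le_one_div_of_le (by norm_num) (by linarith)))
  have h1 : ∑ c, balFill L y e c ^ 2 ≤ 3 / 16 := (sum_sq_le_three_mul_sq hv).trans (by norm_num)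
  have hvn : ‖balFill L y e‖ ≤ 1 / 4 := (pi_norm_le_iff_of_nonneg (by norm_num)).2 fun c => by rw [Real.norm_eq_abs]; exact hv c
  have hbn : ‖y (0, e.2)‖ ≤ 1 / 4 := (pi_norm_le_iff_of_nonneg (by norm_num)).2 fun c => by rw [Real.norm_eq_abs]; exact hb c
  have h2 : |balFill L y e ⬝ᵥ y (0, e.2)| ≤ 3 / 16 :=
    (abs_dotProduct_le_three _ _).trans (by nlinarith [norm_nonneg (balFill L y e), norm_nonneg (y (0, e.2))])
  refine ⟨h1, h2, ?_⟩
  have h3 : Real.sqrt (13 / 16) ≤ Real.sqrt (1 - ∑ c, balFill L y e c ^ 2) := Real.sqrt_le_sqrt (by linarith)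
  have h4 : 3 / 4 ≤ Real.sqrt (13 / 16) := by
    rw [show (3 / 4 : ℝ) = Real.sqrt (9 / 16) by rw [show (9 / 16 : ℝ) = (3 / 4) ^ 2 by norm_num, Real.sqrt_sq (by norm_num)]]
    exact Real.sqrt_le_sqrt (by norm_num)
  have h5 := (abs_le.1 h2).2
  linarith

/-- ★★ **IN THE SMALLNESS REGIME THE TUBE POINT LIES IN THE OPEN UPPER HEMISPHERES** and `gnoPoint (orthoFlat L y e) = (orthoTube L (baseGno L y) (balFill L y)) e`. [folklore] -/
theorem gnoPoint_orthoFlat {y : Edge 3 L → Fin 3 → ℝ} (hy : ‖y‖ ≤ 1 / (4 * Fintype.card (Site 3 L))) (e : Edge 3 L) :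
    0 < scalarPart (orthoTube L (baseGno L y) (balFill L y) e) ∧ gnoPoint (orthoFlat L y e) = orthoTube L (baseGno L y) (balFill L y) e := by
  obtain ⟨h1, -, h3⟩ := orthoFlat_regime L hy e
  have h1' : ∑ c, balFill L y e c ^ 2 ≤ 1 := h1.trans (by norm_num)
  have hpos : 0 < scalarPart (orthoTube L (baseGno L y) (balFill L y) e) := by
    rw [orthoTube_baseGno_apply, scalarPart_chartSU2_mul_gnoPoint h1']
    exact mul_pos (inv_pos.2 (norm_gnomonicQuat_pos _)) (by linarith)
  refine ⟨hpos, ?_⟩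
  rw [orthoFlat_eq_gnLink L y h1', gnoPoint_gnLink _ hpos]

/-- `orthoFlat L 0 = 0`. [folklore] -/
theorem orthoFlat_zero : orthoFlat L 0 = 0 := by
  funext e a
  have hb : balFill L (0 : Edge 3 L → Fin 3 → ℝ) = 0 := balFill_eq_self L (zero_mem_balancedSet L)
  simp [orthoFlat, hb]

end Summit.QuantumFields.YangMills.Theorems.FemtoTransferGap.TwoLattice.ConstTube

end
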